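import Literature.NumberTheory.EllipticCurves.ZpExtensionEisensteinDVRSettingH4KernelProofs
import Literature.NumberTheory.EllipticCurves.ZpExtensionEisensteinDVRSettingH4FbarProofs
import Literature.NumberTheory.EllipticCurves.ZpExtensionEisensteinDVRSettingH4AdjointProofs
import HarnessLib

/-!
# (Ker) for the TWISTED local Eisenstein tower `H¹(K_v, Tw T^{(j)})` — the `Y`-side kernel input of the H.4 descent, by
# TRANSPORT from the place `σ•v` (theorems only)

`Proofs` file (theorems only; no definition, no named fact, no instance, no `sorry`).  Topic `NumberTheory/EllipticCurves`
(D1 road of cell `pub/bsd-print-x9`, LEAD `bsd-line-x10b-p1` g8, brick (M3) of the hfin4 assembly at `v ∈ S`; companion of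
`ZpExtensionEisensteinDVRSettingH4KernelProofs` (p662207, the `X`-side), of x9-p1-w4 g6's `…H4FbarProofs` (p663435: naturality of
Howard's transport `H¹(K_v̄, T) ≅ H¹(K_v, Tw T)` and the transport of level conditions) and of x9-p1-w2 g8's `…H4AdjointMirrorProofs`
(p662903, whose `up′_d` spelling is used verbatim)).

For the mirrored (Dual) step of the descent (liftability on the `X`-side: `Tower.mem_levelCondition_top_of_forall_pairing_bot_eq_zero_of_range`
for the FLIPPED pairing) one needs (Ker) for the tower `Y_j := H¹(K_v, Tw T^{(j)})`.  Instead of presenting the twisted tower, we TRANSPORT: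
`transport_v` is a bijection `H¹(K_v̄, W_j) ≅ H¹(K_v, Tw W_j)` natural in `W_j` (`transportH1_map_localMap`), so `ker H¹(K_v, Tw(×p^d))`
is the transport of `ker H¹(K_v̄, ×p^d)`, which lies in the bottom condition at `v̄ = σ•v` ((Ker) on the `X`-side, p662207), whose
transport is the bottom condition of the twisted tower (`map_transportH1_levelCondition_eq`, cores `⊥ ↦ ⊥`).

* §1 **`WeierstrassCurve.ker_map_twist_eisensteinTwistTorsionTransfer_le_levelCondition_bot`** (F_𝔮 currency, free indices `a ≤ b`,
  the twisted reductions `H¹(K_v, Tw red_j)` spelled `localMap (restrictMap (eisensteinTwistReduce …) cd.conj)` as in (F̄));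
* §2 the `D`-indexed form **`WeierstrassCurve.eisensteinTower_ker_map_twist_transfer_le_levelCondition_bot`**: for
  `T := W.eisensteinTower κ hm`, `Y_j = H¹(K_v, Tw T^{(j)})`, `red′_j = ContinuousRep.cohomologyMap … (T.red j) …` and
  `up′_d = galoisCohomology.map (localMap (restrictMap (E_K.eisensteinTwistTorsionTransfer κ hm t (torsionGaloisModuleReduce_coe) (k+1) (k+d+1))
  cd.conj) (Sum.inr v)) 1` (x9-p1-w2 g8's spelling): **`ker up′_d ≤ Tower.levelCondition red′ p ⊥ k`** — the binder `hKer` of the flipped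
  (Dual) step; plus the `X`-side lemma restated in the same `torsionGaloisModuleReduce_coe` spelling.
No summit statement is proved; BSD is not proved by any of this.

References: B. Howard, Compositio Math. 140 (2004), §1.3 (Tw(T), transport), H.4, Def. 3.2.6 (arXiv:1202.6340 p. 7 L33–48, L69–82,
p. 16); J.-P. Serre, *Galois Cohomology* (1997), I §2.2, §2.4.
-/

set_option autoImplicit false

noncomputable section

open Function NumberField IsDedekindDomain Field CategoryTheory
open scoped NumberField ContRepresentation TensorProduct Classical

namespace WeierstrassCurve

open Literature.NumberTheory.EllipticCurves Literature.NumberTheory.GaloisRepresentations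
open Literature.NumberTheory.GaloisRepresentations.DiscreteGaloisModule
open Literature.NumberTheory.GaloisCohomology.Howard2004
open Literature.NumberTheory.EllipticCurves.ZpExtension (EisensteinLevel)

variable {K : Type} [Field K] [NumberField K] (W : WeierstrassCurve ℚ) [W.IsElliptic] {p : ℕ} [hp : Fact p.Prime]
  (κ : ZpExtension K p) {m : ℕ} (hm : 1 ≤ m) (cd : ConjugationDatum K)

/-! ## §1 F_𝔮 currency: transport of (Ker) from `σ•v` -/

set_option maxHeartbeats 800000 in
/-- **(Ker) for the twisted local Eisenstein tower of the curve (F_𝔮 currency, free indices).**  For `a ≤ b`, a finite place `v`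
and any conjugation datum `cd`: the kernel of `H¹(K_v, Tw(×p^{b-a}) : Tw W_a → Tw W_b)` (`W_j = E_K[p^j] ⊗ A_{m,j}(ψ)`) lies in the bottom
level condition of the tower `j ↦ H¹(K_v, Tw W_j)` with the reductions `H¹(K_v, Tw red_j)` — by transport from (Ker) at `σ•v`.
[cite: Howard2004HeegnerKolyvagin, §1.3 (Tw(T), transport) and H.4 (arXiv p. 7 L33–48, L78–82)] [cite: SerreGaloisCohomology1997, Ch. I §2.2, §2.4] -/
theorem ker_map_twist_eisensteinTwistTorsionTransfer_le_levelCondition_bot (v : HeightOneSpectrum (𝓞 K)) {a b : ℕ}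
    (hab : a ≤ b) :
    (galoisCohomology.map (Literature.NumberTheory.EllipticCurves.DiscreteGaloisModule.localMap (Literature.NumberTheory.EllipticCurves.DiscreteGaloisModule.restrictMap
        ((W.baseChange K).eisensteinTwistTorsionTransfer κ hm (fun j ↦ (W.baseChange K).torsionGaloisModuleReduce p j)
          (W.torsionGaloisModuleReduce_coe (K := K) (p := p)) a b) cd.conj) (Sum.inr v)) 1).ker ≤
      Tower.levelCondition
        (H := fun j ↦ galoisCohomology ((cd.twist
          (κ.eisensteinTwist ((W.baseChange K).torsionGaloisModule ((p : ℤ) ^ j)) hm j)).toLocal (Sum.inr v)) 1)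
        (fun j ↦ galoisCohomology.map (Literature.NumberTheory.EllipticCurves.DiscreteGaloisModule.localMap
          (Literature.NumberTheory.EllipticCurves.DiscreteGaloisModule.restrictMap
            (κ.eisensteinTwistReduce hm (Nat.le_succ j) ((W.baseChange K).torsionGaloisModuleReduce p j)) cd.conj)
          (Sum.inr v)) 1) p
        (fun j ↦ (⊥ : AddSubgroup (galoisCohomology ((cd.twist
          (κ.eisensteinTwist ((W.baseChange K).torsionGaloisModule ((p : ℤ) ^ j)) hm j)).toLocal (Sum.inr v)) 1))) a := by
  intro y hy
  -- `y` is a transport from `σ•v`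
  obtain ⟨x, rfl⟩ := cd.transportH1_surjective
    (κ.eisensteinTwist ((W.baseChange K).torsionGaloisModule ((p : ℤ) ^ a)) hm a) v y
  -- naturality: `up′ (transport x) = transport (up x)`, so `up x = 0`
  have hnat := cd.transportH1_map_localMap
    (κ.eisensteinTwist ((W.baseChange K).torsionGaloisModule ((p : ℤ) ^ a)) hm a)
    (κ.eisensteinTwist ((W.baseChange K).torsionGaloisModule ((p : ℤ) ^ b)) hm b)
    ((W.baseChange K).eisensteinTwistTorsionTransfer κ hm (fun j ↦ (W.baseChange K).torsionGaloisModuleReduce p j)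
      (W.torsionGaloisModuleReduce_coe (K := K) (p := p)) a b) v x
  have hx0 := cd.transportH1_injective (κ.eisensteinTwist ((W.baseChange K).torsionGaloisModule ((p : ℤ) ^ b)) hm b) v
    ((hnat.trans ((AddMonoidHom.mem_ker).1 hy)).trans (map_zero _).symm)
  -- (Ker) at `σ•v` on the `X`-side (F_𝔮 currency: `eisensteinLocalReduce` IS `H¹(red_j)` levelwise)
  have hx : x ∈ Tower.levelCondition
      (H := fun j ↦ galoisCohomology
        ((κ.eisensteinTwist ((W.baseChange K).torsionGaloisModule ((p : ℤ) ^ j)) hm j).toLocal (Sum.inr (cd.σ • v))) 1)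
      (fun j ↦ galoisCohomology.map (Literature.NumberTheory.EllipticCurves.DiscreteGaloisModule.localMap
        (κ.eisensteinTwistReduce hm (Nat.le_succ j) ((W.baseChange K).torsionGaloisModuleReduce p j))
        (Sum.inr (cd.σ • v))) 1) p
      (fun j ↦ (⊥ : AddSubgroup (galoisCohomology
        ((κ.eisensteinTwist ((W.baseChange K).torsionGaloisModule ((p : ℤ) ^ j)) hm j).toLocal (Sum.inr (cd.σ • v))) 1))) a :=
    W.ker_map_eisensteinTwistTorsionTransfer_le_levelCondition_bot κ hm (cd.σ • v) hab ((AddMonoidHom.mem_ker).2 hx0)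
  -- transport of the bottom level condition
  have hmem : cd.transportH1 (κ.eisensteinTwist ((W.baseChange K).torsionGaloisModule ((p : ℤ) ^ a)) hm a) v x ∈
      (Tower.levelCondition
        (H := fun j ↦ galoisCohomology
          ((κ.eisensteinTwist ((W.baseChange K).torsionGaloisModule ((p : ℤ) ^ j)) hm j).toLocal (Sum.inr (cd.σ • v))) 1)
        (fun j ↦ galoisCohomology.map (Literature.NumberTheory.EllipticCurves.DiscreteGaloisModule.localMap
          (κ.eisensteinTwistReduce hm (Nat.le_succ j) ((W.baseChange K).torsionGaloisModuleReduce p j))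
          (Sum.inr (cd.σ • v))) 1) p
        (fun j ↦ (⊥ : AddSubgroup (galoisCohomology
          ((κ.eisensteinTwist ((W.baseChange K).torsionGaloisModule ((p : ℤ) ^ j)) hm j).toLocal (Sum.inr (cd.σ • v))) 1)))
        a).map (cd.transportH1 (κ.eisensteinTwist ((W.baseChange K).torsionGaloisModule ((p : ℤ) ^ a)) hm a) v) :=
    ⟨x, hx, rfl⟩
  rw [cd.map_transportH1_levelCondition_eq (fun j ↦ κ.eisensteinTwist ((W.baseChange K).torsionGaloisModule ((p : ℤ) ^ j)) hm j)
    (fun j ↦ κ.eisensteinTwistReduce hm (Nat.le_succ j) ((W.baseChange K).torsionGaloisModuleReduce p j)) v p _ a] at hmem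
  have hbot : (fun j ↦ (⊥ : AddSubgroup (galoisCohomology
      ((κ.eisensteinTwist ((W.baseChange K).torsionGaloisModule ((p : ℤ) ^ j)) hm j).toLocal (Sum.inr (cd.σ • v))) 1)).map
        (cd.transportH1 (κ.eisensteinTwist ((W.baseChange K).torsionGaloisModule ((p : ℤ) ^ j)) hm j) v)) =
      (fun j ↦ (⊥ : AddSubgroup (galoisCohomology ((cd.twist
        (κ.eisensteinTwist ((W.baseChange K).torsionGaloisModule ((p : ℤ) ^ j)) hm j)).toLocal (Sum.inr v)) 1))) :=
    funext fun j ↦ AddSubgroup.map_bot _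
  rw [hbot] at hmem
  exact hmem

/-! ## §2 The `D`-indexed currency -/

omit [W.IsElliptic] in
/-- `H¹(K_v, Tw(E_K[1] ⊗ A_{m,0}(ψ)))` is trivial (the level-`0` module is zero). [cite: SerreGaloisCohomology1997, I §2.2] -/
theorem subsingleton_galoisCohomology_twist_eisensteinLevel_zero (v : Place K) :
    Subsingleton (galoisCohomology
      ((cd.twist (κ.eisensteinTwist ((W.baseChange K).torsionGaloisModule ((p : ℤ) ^ 0)) hm 0)).toLocal v) 1) := by
  have hM : ∀ x : IwasawaAlgebra.EisensteinCoeff.Twisted p m 0 (geomTorsion (W.baseChange K) ((p : ℤ) ^ 0)),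
      1 • x = 0 := fun x ↦ by
    rw [W.eisensteinLevel_zero_eq_zero hm x, smul_zero]
  have h : ∀ c : galoisCohomology
      ((cd.twist (κ.eisensteinTwist ((W.baseChange K).torsionGaloisModule ((p : ℤ) ^ 0)) hm 0)).toLocal v) 1, c = 0 :=
    fun c ↦ by simpa using galoisCohomology.nsmul_eq_zero_of_forall _ hM c
  exact ⟨fun a b ↦ by rw [h a, h b]⟩

set_option maxHeartbeats 1000000 in
/-- The twisted one-step reduction of the `F_𝔮` tower at level `j+1` IS `H¹(K_v, Tw red_j)` of the curve's tower in the
`ContinuousRep.cohomologyMap` currency of (H4-PERF-INST)/(M2) (both are Mathlib's `ContinuousCohomology.map` of the same map).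
[cite: Howard2004HeegnerKolyvagin, §1.3 (Tw(T)) and §1.6 (arXiv p. 12)] -/
theorem map_twist_eisensteinTwistReduce_succ_eq_cohomologyMap (v : Place K) (j : ℕ) :
    letI := IwasawaAlgebra.isLocalRing_quotient_X_pow_add_C p hm
    galoisCohomology.map (Literature.NumberTheory.EllipticCurves.DiscreteGaloisModule.localMap (Literature.NumberTheory.EllipticCurves.DiscreteGaloisModule.restrictMap
        (κ.eisensteinTwistReduce hm (Nat.le_succ (j + 1)) ((W.baseChange K).torsionGaloisModuleReduce p (j + 1))) cd.conj) v) 1 =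
      ContinuousRep.cohomologyMap ((cd.twist ((W.eisensteinTower κ hm).ρ (j + 1))).toLocal v)
        ((cd.twist ((W.eisensteinTower κ hm).ρ j)).toLocal v) ((W.eisensteinTower κ hm).red j).toAddMonoidHom
        continuous_of_discreteTopology (fun _ z => (W.eisensteinTower κ hm).red_equivariant j _ z) 1 :=
  rfl

set_option maxHeartbeats 1000000 in
/-- **(Ker) for the twisted tower of the curve, `D`-indexed**: for `T := W.eisensteinTower κ hm`, any conjugation datum `cd`,
a finite place `v` and `k d : ℕ`, the kernel of `up′_d := H¹(K_v, Tw(×p^d) : Tw T^{(k)} → Tw T^{(k+d)})` lies in the bottom level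
condition of the tower `j ↦ H¹(K_v, Tw T^{(j)})` with the reductions `H¹(Tw T.red j)` — the binder `hKer` of the FLIPPED (Dual) step
(`up′_d` spelled as in `eisensteinTower_localCup_towerAdjoint_left`).
[cite: Howard2004HeegnerKolyvagin, §1.3 (Tw(T)), H.4 and Def. 3.2.6 (arXiv p. 7 L33–48, L78–82, p. 16)] [cite: SerreGaloisCohomology1997, Ch. I §2.2] -/
theorem eisensteinTower_ker_map_twist_transfer_le_levelCondition_bot (v : HeightOneSpectrum (𝓞 K)) (k d : ℕ) :
    letI := IwasawaAlgebra.isLocalRing_quotient_X_pow_add_C p hm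
    (galoisCohomology.map (Literature.NumberTheory.EllipticCurves.DiscreteGaloisModule.localMap (Literature.NumberTheory.EllipticCurves.DiscreteGaloisModule.restrictMap
        ((W.baseChange K).eisensteinTwistTorsionTransfer κ hm (fun j ↦ (W.baseChange K).torsionGaloisModuleReduce p j)
          (W.torsionGaloisModuleReduce_coe (K := K) (p := p)) (k + 1) (k + d + 1)) cd.conj) (Sum.inr v)) 1).ker ≤
      Tower.levelCondition (H := fun j ↦ galoisCohomology ((cd.twist ((W.eisensteinTower κ hm).ρ j)).toLocal (Sum.inr v)) 1)
        (fun j ↦ ContinuousRep.cohomologyMap ((cd.twist ((W.eisensteinTower κ hm).ρ (j + 1))).toLocal (Sum.inr v))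
          ((cd.twist ((W.eisensteinTower κ hm).ρ j)).toLocal (Sum.inr v)) ((W.eisensteinTower κ hm).red j).toAddMonoidHom
          continuous_of_discreteTopology (fun _ z => (W.eisensteinTower κ hm).red_equivariant j _ z) 1)
        p (fun j ↦ (⊥ : AddSubgroup (galoisCohomology
          ((cd.twist ((W.eisensteinTower κ hm).ρ j)).toLocal (Sum.inr v)) 1))) k := by
  letI := IwasawaAlgebra.isLocalRing_quotient_X_pow_add_C p hm
  have h1 := W.ker_map_twist_eisensteinTwistTorsionTransfer_le_levelCondition_bot κ hm cd v
    (show k + 1 ≤ k + d + 1 by omega)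
  haveI := W.subsingleton_galoisCohomology_twist_eisensteinLevel_zero κ hm cd (Sum.inr v)
  refine h1.trans (le_of_eq ?_)
  rw [Tower.levelCondition_succ_eq_levelCondition_shift _ p _ k]
  simp only [W.map_twist_eisensteinTwistReduce_succ_eq_cohomologyMap κ hm cd (Sum.inr v)]
  rfl

/-- The `X`-side (Ker) (p662207) restated with x9-p1-w2 g8's `torsionGaloisModuleReduce_coe` spelling of the two-index family.
[cite: Howard2004HeegnerKolyvagin, §1.3 H.4 and Def. 3.2.6 (arXiv p. 7 L78–82, p. 16)] -/
theorem eisensteinTower_ker_map_transfer_le_levelCondition_bot' (v : HeightOneSpectrum (𝓞 K)) (k d : ℕ) :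
    letI := IwasawaAlgebra.isLocalRing_quotient_X_pow_add_C p hm
    (galoisCohomology.map (Literature.NumberTheory.EllipticCurves.DiscreteGaloisModule.localMap
        ((W.baseChange K).eisensteinTwistTorsionTransfer κ hm (fun j ↦ (W.baseChange K).torsionGaloisModuleReduce p j)
          (W.torsionGaloisModuleReduce_coe (K := K) (p := p)) (k + 1) (k + d + 1)) (Sum.inr v)) 1).ker ≤
      Tower.levelCondition (H := fun j ↦ galoisCohomology (((W.eisensteinTower κ hm).ρ j).toLocal (Sum.inr v)) 1)
        (fun j ↦ ContinuousRep.cohomologyMap (((W.eisensteinTower κ hm).ρ (j + 1)).toLocal (Sum.inr v))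
          (((W.eisensteinTower κ hm).ρ j).toLocal (Sum.inr v)) ((W.eisensteinTower κ hm).red j).toAddMonoidHom
          continuous_of_discreteTopology (fun _ z => (W.eisensteinTower κ hm).red_equivariant j _ z) 1)
        p (fun j ↦ (⊥ : AddSubgroup (galoisCohomology (((W.eisensteinTower κ hm).ρ j).toLocal (Sum.inr v)) 1))) k :=
  W.eisensteinTower_ker_map_transfer_le_levelCondition_bot κ hm v k d

end WeierstrassCurve

end
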